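import Summits.BirchSwinnertonDyer.BirchSwinnertonDyer.Theorems.PrintCf2RamifiedOffTYZOrbitStableProduct
import Literature.NumberTheory.EllipticCurves.TianYuanZhang2017.CMPointSevenBlockDisplays
import HarnessLib

/-!
# Route `PrintCf2`, crux stmt-BirchSwinnertonDyer-20509 `RamifiedOffTYZOfFacts`, THEOREM A's steps (R6)/(R7) on the realisation side:
# the first norm `N₁ = ∏_{t∈Φ} t x₀` of ANY realisation `Φ` is a square over `k₀ = M^N` as soon as the ONE orbit product
# `∏_{(x,y) ∈ N•(x₀,y₀)} x` is — and that orbit product is `(∏_{x ∈ N•x₀} x)^k`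
# (cell `bsd-print-cf2`, LEAD cruxlead-20509 g32, line `offtyz-v7`, lineage cycle 33; fact-free, Theses-free, `def`-free)

HONEST FRAMING (`--supports stmt-BirchSwinnertonDyer-20509`; theorems only).  BSD is not proved by any of this; no class is closed by this file;
item 23431 (C⁺) and crux 20509 stay OPEN.  Steps (R6)/(R7) of THEOREM A's kernel road (memo `Cruxes/RamifiedOffTYZOfFacts/Lines/offtyz_v7_TheoremARoad.md`
§3, §3c) INSTANTIATED on the objects of the seven-block display: a number field `M`, a point `z = (x₀, y₀) ∈ A(M)`, a finite set `Φ ⊂ Aut_ℚ(M)`, a subgroup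
`N ≤ Aut_ℚ(M)` under which the family `(t•z)_{t∈Φ}` is stable as a multiset (sentence (S3), for the automorphisms trivial on `ι L_n(i)`), and the fixed field
`k₀ = M^N` (`IntermediateField.fixedField N`).

* `pairs_stable_of_points_stable` — (S3) on POINTS (`galPtOver`) gives the multiset-stability of the coordinate PAIRS `(t x₀, t y₀)` under `N` (componentwise
  action of `Aut_ℚ(M)` on `M × M`).
* ★ `firstNorm_sq_of_orbit_sq` — **if `N` is normal in `Aut_ℚ(M)` and the pair-orbit product `∏_{p ∈ N•(x₀,y₀)} p.1` is the square of an element of `k₀`, then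
  `∏_{t∈Φ} t x₀` is the square of an element of `k₀`** — for EVERY `Φ` as in (S3), whatever its orbit multiplicities (`OrbitStableProduct.prod_mem_of_orbitProd_mem`,
  p811539, with the submonoid of squares of `k₀`; normality moves the orbit of a conjugate pair to the conjugate of the orbit).
* `orbitProd_fst_eq_pow` — the pair-orbit product is `(∏_{x ∈ N•x₀} x)^k`, `k = #{p ∈ N•(x₀,y₀) : p.1 = x₀}` (the fibre count, `= [Stab_N x₀ : Stab_N (x₀,y₀)]`,
  here `1` or `2`); `orbitProd_mem_fixedField` — `∏_{x ∈ N•x₀} x ∈ k₀`; hence (`orbitProd_fst_sq_of_even`) for EVEN `k` the pair-orbit product is a square over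
  `k₀` with no arithmetic at all, and for `k = 1` (`orbitProd_fst_eq_of_count_eq_one`) it is the plain orbit product `∏_{x∈N•x₀} x` — the field norm
  `N_{k₀(x₀)/k₀}(x₀)`, the object the CM side (R0)–(R2′) evaluates through the half-norm transfer.

So THEOREM A for a realisation `(M, ι, x₀, y₀, Φ)` is REDUCED to: «`∏_{x ∈ N•x₀} x` is a square in `k₀`, granted `Stab_N(x₀) = Stab_N(x₀, y₀)`», `N` the
automorphisms trivial on `ι L_n(i)`.  PROOFS ONLY; nothing arithmetic.

References: [cite: TianYuanZhang2017, §3.1 (p0011 L53–L58)] (the shape of (S3)); orbit decomposition [folklore]; tree p811539.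
-/

noncomputable section

open scoped Classical

namespace Summit.BirchSwinnertonDyer.PrintCf2.TheoremAOrbitReduction

open Finset MulAction WeierstrassCurve
open Literature.NumberTheory.EllipticCurves.TianYuanZhang2017
open Literature.NumberTheory.EllipticCurves.TianYuanZhang2017.GenusPointData (galPtOver)
open Summit.BirchSwinnertonDyer.PrintCf2.OrbitStableProduct

variable {M : Type} [Field M] [NumberField M]

/-! ## §1 From (S3) on points to the coordinate pairs -/

/-- `galPtOver` acts coordinatewise on affine points. [cite: TianYuanZhang2017, §3.1 (p0011 L53–L58)] -/
theorem galPtOver_some (g : M ≃ₐ[ℚ] M) {x y : M} (h : (curveA.baseChange M).toAffine.Nonsingular x y) :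
    ∃ h' : (curveA.baseChange M).toAffine.Nonsingular (g x) (g y), galPtOver M g (.some x y h) = .some (g x) (g y) h' := by
  have h' : (curveA.baseChange M).toAffine.Nonsingular (g x) (g y) := by
    rw [curveA_nonsingular_iff] at h ⊢
    have := congrArg g h
    simpa [map_ofNat] using this
  exact ⟨h', rfl⟩

/-- **(S3) on points ⟹ multiset-stability of the coordinate pairs**: if `g` permutes the points `t•z` (`z = (x₀,y₀)`), it permutes the pairs
`(t x₀, t y₀)` for the componentwise action of `Aut_ℚ(M)` on `M × M`. [cite: TianYuanZhang2017, §3.1 (p0011 L53–L58)] -/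
theorem pairs_stable_of_points_stable {x₀ y₀ : M} {h₀ : (curveA.baseChange M).toAffine.Nonsingular x₀ y₀} {Φ : Finset (M ≃ₐ[ℚ] M)}
    {g : M ≃ₐ[ℚ] M}
    (hS3 : ∃ π : Φ → Φ, Function.Bijective π ∧
      ∀ t : Φ, galPtOver M g (galPtOver M (t : M ≃ₐ[ℚ] M) (.some x₀ y₀ h₀)) = galPtOver M (π t : M ≃ₐ[ℚ] M) (.some x₀ y₀ h₀)) :
    ∃ π : Φ → Φ, Function.Bijective π ∧
      ∀ t : Φ, g • ((fun s : M ≃ₐ[ℚ] M => ((s x₀, s y₀) : M × M)) t) = (fun s : M ≃ₐ[ℚ] M => ((s x₀, s y₀) : M × M)) (π t) := by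
  obtain ⟨π, hbij, hπ⟩ := hS3
  refine ⟨π, hbij, fun t => ?_⟩
  have h := hπ t
  obtain ⟨h₁, e₁⟩ := galPtOver_some (t : M ≃ₐ[ℚ] M) h₀
  obtain ⟨h₂, e₂⟩ := galPtOver_some g h₁
  obtain ⟨h₃, e₃⟩ := galPtOver_some (π t : M ≃ₐ[ℚ] M) h₀
  rw [e₁, e₂, e₃] at h
  have hc := (Affine.Point.some.injEq _ _ _ _ _ _).mp h
  simp only [Prod.smul_mk, AlgEquiv.smul_def, Prod.mk.injEq]
  exact ⟨hc.1, hc.2⟩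

/-! ## §2 The reduction of `∏_{t∈Φ} t x₀` to the one pair-orbit product -/

/-- For a NORMAL subgroup `N`, the `N`-orbit of a translate is the translate of the orbit: the orbit product of `t • p` is `t` applied to the orbit product
of `p` (first coordinates; `t` is a ring automorphism). [folklore] -/
theorem orbitProd_fst_smul (N : Subgroup (M ≃ₐ[ℚ] M)) [N.Normal] (t : M ≃ₐ[ℚ] M) (p : M × M) :
    ∏ q ∈ (Finset.univ : Finset N).image (fun g => g • (t • p)), q.1 = t (∏ q ∈ (Finset.univ : Finset N).image (fun g => g • p), q.1) := by
  rw [map_prod]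
  -- reindex the orbit of `t • p` by conjugation `g ↦ t⁻¹ g t`
  have hconj : ∀ g : N, (t⁻¹ * (g : M ≃ₐ[ℚ] M) * t) ∈ N := fun g => by
    have := ‹N.Normal›.conj_mem (g : M ≃ₐ[ℚ] M) g.2 t⁻¹
    simpa using this
  -- the orbit of `t • p` is the image of the orbit of `p` under `q ↦ t • q`
  have himage : (Finset.univ : Finset N).image (fun g => g • (t • p)) =
      ((Finset.univ : Finset N).image (fun g => g • p)).image (fun q => t • q) := by
    ext q
    simp only [Finset.mem_image, Finset.mem_univ, true_and]
    constructor
    · rintro ⟨g, rfl⟩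
      refine ⟨(⟨t⁻¹ * (g : M ≃ₐ[ℚ] M) * t, hconj g⟩ : N) • p, ⟨⟨t⁻¹ * (g : M ≃ₐ[ℚ] M) * t, hconj g⟩, rfl⟩, ?_⟩
      rw [Subgroup.mk_smul, Subgroup.smul_def, smul_smul, smul_smul]
      congr 1
      group
    · rintro ⟨q, ⟨g, rfl⟩, rfl⟩
      refine ⟨⟨t * (g : M ≃ₐ[ℚ] M) * t⁻¹, ‹N.Normal›.conj_mem _ g.2 t⟩, ?_⟩
      rw [Subgroup.mk_smul, Subgroup.smul_def, smul_smul, smul_smul]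
      congr 1
      group
  rw [himage, Finset.prod_image]
  · refine Finset.prod_congr rfl fun q _ => ?_
    rw [Prod.smul_fst, AlgEquiv.smul_def]
  · intro q₁ _ q₂ _ h
    exact smul_left_cancel t h

/-- An element fixed by every `g ∈ N` lies in the fixed field `k₀ = M^N`; squares of `k₀` are permuted by the automorphisms normalising `N`. [folklore] -/
theorem map_mem_fixedField_of_normal (N : Subgroup (M ≃ₐ[ℚ] M)) [N.Normal] (t : M ≃ₐ[ℚ] M) {r : M}
    (hr : r ∈ IntermediateField.fixedField N) : t r ∈ IntermediateField.fixedField N := by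
  rw [IntermediateField.mem_fixedField_iff] at hr ⊢
  intro g hg
  have hconj : t⁻¹ * g * t ∈ N := by
    have := ‹N.Normal›.conj_mem g hg t⁻¹
    simpa using this
  have := hr _ hconj
  -- `(t⁻¹ g t) r = r` ⟹ `g (t r) = t r`
  have e : g (t r) = t ((t⁻¹ * g * t) r) := by
    simp [AlgEquiv.mul_apply]
  rw [e, this]

/-- ★ **THE REDUCTION.**  `N ◁ Aut_ℚ(M)`; `z = (x₀, y₀) ∈ A(M)`; `Φ` with (S3) for all `g ∈ N`.  If the pair-orbit product `∏_{p ∈ N•(x₀,y₀)} p.1` is `r²` with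
`r ∈ k₀ = M^N`, then `∏_{t∈Φ} t x₀ = r′²` with `r′ ∈ k₀`.  (Every orbit product of the family is a conjugate `t(r)²`, `t r ∈ k₀`; then
`OrbitStableProduct.prod_mem_of_orbitProd_mem` with the submonoid of squares of `k₀`.) [cite: TianYuanZhang2017, §3.1 (p0011 L53–L58)] -/
theorem firstNorm_sq_of_orbit_sq (N : Subgroup (M ≃ₐ[ℚ] M)) [N.Normal] {x₀ y₀ : M}
    {h₀ : (curveA.baseChange M).toAffine.Nonsingular x₀ y₀} {Φ : Finset (M ≃ₐ[ℚ] M)}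
    (hS3 : ∀ g : M ≃ₐ[ℚ] M, g ∈ N → ∃ π : Φ → Φ, Function.Bijective π ∧
      ∀ t : Φ, galPtOver M g (galPtOver M (t : M ≃ₐ[ℚ] M) (.some x₀ y₀ h₀)) = galPtOver M (π t : M ≃ₐ[ℚ] M) (.some x₀ y₀ h₀))
    (horb : ∃ r ∈ IntermediateField.fixedField N, ∏ q ∈ (Finset.univ : Finset N).image (fun g => g • ((x₀, y₀) : M × M)), q.1 = r ^ 2) :
    ∃ r ∈ IntermediateField.fixedField N, ∏ t ∈ Φ, (t : M ≃ₐ[ℚ] M) x₀ = r ^ 2 := by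
  -- the submonoid of squares of `k₀`
  let S : Submonoid M :=
    { carrier := {m | ∃ r ∈ IntermediateField.fixedField N, m = r ^ 2}
      mul_mem' := by
        rintro a b ⟨r, hr, rfl⟩ ⟨s, hs, rfl⟩
        exact ⟨r * s, mul_mem hr hs, by ring⟩
      one_mem' := ⟨1, one_mem _, by ring⟩ }
  -- the family of coordinate pairs and its stability under `N`
  let y : (M ≃ₐ[ℚ] M) → M × M := fun s => (s x₀, s y₀)
  have hstab : ∀ g : N, ∃ π : Φ → Φ, Function.Bijective π ∧ ∀ t : Φ, g • y t = y (π t) := by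
    intro g
    obtain ⟨π, hbij, hπ⟩ := pairs_stable_of_points_stable (hS3 g g.2)
    exact ⟨π, hbij, fun t => by rw [Subgroup.smul_def]; exact hπ t⟩
  -- every orbit product lies in `S`
  obtain ⟨r, hr, hprod⟩ := horb
  have horbS : ∀ t ∈ Φ, (∏ q ∈ (Finset.univ : Finset N).image (fun g => g • y t), q.1) ∈ S := by
    intro t _
    have e : y t = t • ((x₀, y₀) : M × M) := by simp [y, Prod.smul_mk, AlgEquiv.smul_def]
    rw [e, orbitProd_fst_smul N t, hprod, map_pow]
    exact ⟨t r, map_mem_fixedField_of_normal N t hr, rfl⟩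
  have hmem : (∏ t ∈ Φ, Prod.fst (y t)) ∈ S := by
    refine prod_mem_of_orbitProd_mem (N := N) (X := M × M) S Prod.fst Φ y hstab (fun t ht => ?_)
    -- (the `Finset.image` of the landed lemma carries the classical `DecidableEq` on pairs; `convert` bridges the instances)
    convert horbS t ht
  obtain ⟨r', hr', h'⟩ := hmem
  exact ⟨r', hr', h'⟩

/-! ## §3 The pair-orbit product versus the plain orbit product of `x₀` -/

/-- The plain orbit product `∏_{x ∈ N•x₀} x` is `N`-invariant, hence lies in `k₀ = M^N`. [folklore] -/
theorem orbitProd_mem_fixedField (N : Subgroup (M ≃ₐ[ℚ] M)) (x₀ : M) :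
    (∏ x ∈ (Finset.univ : Finset N).image (fun g => g • x₀), x) ∈ IntermediateField.fixedField N := by
  rw [IntermediateField.mem_fixedField_iff]
  intro g hg
  rw [map_prod]
  -- `g` permutes the orbit
  have himage : ((Finset.univ : Finset N).image (fun g => g • x₀)).image (fun x => g x) = (Finset.univ : Finset N).image (fun g => g • x₀) := by
    have hfun : (fun x => g x) ∘ (fun g' : N => g' • x₀) = (fun g' : N => g' • x₀) ∘ (fun g' : N => (⟨g, hg⟩ : N) * g') := by
      funext g'
      simp only [Function.comp_apply]
      rw [mul_smul, Subgroup.smul_def (⟨g, hg⟩ : N), AlgEquiv.smul_def]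
    rw [Finset.image_image, hfun, ← Finset.image_image, Finset.image_univ_of_surjective (mul_left_surjective (⟨g, hg⟩ : N))]
  have hinj : ∀ x₁ ∈ (Finset.univ : Finset N).image (fun g => g • x₀), ∀ x₂ ∈ (Finset.univ : Finset N).image (fun g => g • x₀),
      (fun x => g x) x₁ = (fun x => g x) x₂ → x₁ = x₂ := fun x₁ _ x₂ _ h => g.injective h
  rw [← Finset.prod_image (g := fun x => g x) (f := fun x => x) hinj, himage]

/-- **The pair-orbit product is a power of the plain orbit product**: `∏_{p ∈ N•(x₀,y₀)} p.1 = (∏_{x ∈ N•x₀} x)^k` with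
`k = #{p ∈ N•(x₀,y₀) : p.1 = x₀}` (the common fibre count). [folklore] -/
theorem orbitProd_fst_eq_pow (N : Subgroup (M ≃ₐ[ℚ] M)) (x₀ y₀ : M) :
    ∏ q ∈ (Finset.univ : Finset N).image (fun g => g • ((x₀, y₀) : M × M)), q.1 =
      (∏ x ∈ (Finset.univ : Finset N).image (fun g => g • x₀), x) ^
        (((Finset.univ : Finset N).image (fun g => g • ((x₀, y₀) : M × M))).filter fun q => q.1 = x₀).card := by
  -- the family `q ↦ q.1` on the orbit `O` is `N`-stable as a multiset
  have hstab : ∀ g : N, ∃ π : ((Finset.univ : Finset N).image (fun g => g • ((x₀, y₀) : M × M))) →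
        ((Finset.univ : Finset N).image (fun g => g • ((x₀, y₀) : M × M))),
      Function.Bijective π ∧ ∀ t : ((Finset.univ : Finset N).image (fun g => g • ((x₀, y₀) : M × M))),
        g • (fun q : M × M => q.1) t = (fun q : M × M => q.1) (π t) := by
    intro g
    have hmaps : ∀ q : ((Finset.univ : Finset N).image (fun g => g • ((x₀, y₀) : M × M))),
        g • (q : M × M) ∈ (Finset.univ : Finset N).image (fun g => g • ((x₀, y₀) : M × M)) := by
      intro q
      obtain ⟨g', -, hq⟩ := Finset.mem_image.mp q.2
      exact Finset.mem_image.mpr ⟨g * g', Finset.mem_univ _, by rw [mul_smul, hq]⟩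
    refine ⟨fun q => ⟨g • (q : M × M), hmaps q⟩, ?_, fun q => by simp [Prod.smul_fst]⟩
    apply Finite.injective_iff_bijective.mp
    intro q₁ q₂ h
    have := congrArg (fun s : ((Finset.univ : Finset N).image (fun g => g • ((x₀, y₀) : M × M))) => (s : M × M)) h
    exact Subtype.ext (smul_left_cancel g this)
  have key := prod_filter_mem_orbit_eq_pow (N := N) (X := M) (ι := M × M)
    (Φ := (Finset.univ : Finset N).image (fun g => g • ((x₀, y₀) : M × M))) (y := fun q : M × M => q.1) hstab (fun x => x) x₀
  -- every pair of the orbit has first coordinate in the orbit of `x₀`, so the filter is all of the orbit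
  have hall : ((Finset.univ : Finset N).image (fun g => g • ((x₀, y₀) : M × M))).filter
      (fun q : M × M => q.1 ∈ (Finset.univ : Finset N).image (fun g => g • x₀)) =
      (Finset.univ : Finset N).image (fun g => g • ((x₀, y₀) : M × M)) := by
    apply Finset.filter_true_of_mem
    intro q hq
    obtain ⟨g, -, rfl⟩ := Finset.mem_image.mp hq
    exact Finset.mem_image.mpr ⟨g, Finset.mem_univ _, by rw [Prod.smul_fst]⟩
  rw [hall] at key
  exact key

/-- For an EVEN fibre count the pair-orbit product is the square of an element of `k₀` — no arithmetic needed. [folklore] -/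
theorem orbitProd_fst_sq_of_even (N : Subgroup (M ≃ₐ[ℚ] M)) (x₀ y₀ : M)
    (heven : Even (((Finset.univ : Finset N).image (fun g => g • ((x₀, y₀) : M × M))).filter fun q => q.1 = x₀).card) :
    ∃ r ∈ IntermediateField.fixedField N, ∏ q ∈ (Finset.univ : Finset N).image (fun g => g • ((x₀, y₀) : M × M)), q.1 = r ^ 2 := by
  obtain ⟨k, hk⟩ := heven
  refine ⟨(∏ x ∈ (Finset.univ : Finset N).image (fun g => g • x₀), x) ^ k, pow_mem (orbitProd_mem_fixedField N x₀) k, ?_⟩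
  rw [orbitProd_fst_eq_pow, hk, ← two_mul, pow_mul, sq, sq]
  ring

/-- For fibre count `1` (`Stab_N(x₀) = Stab_N(x₀,y₀)`) the pair-orbit product IS the plain orbit product `∏_{x ∈ N•x₀} x` (`= N_{k₀(x₀)/k₀}(x₀)`, the CM side's
object). [folklore] -/
theorem orbitProd_fst_eq_of_count_eq_one (N : Subgroup (M ≃ₐ[ℚ] M)) (x₀ y₀ : M)
    (hone : (((Finset.univ : Finset N).image (fun g => g • ((x₀, y₀) : M × M))).filter fun q => q.1 = x₀).card = 1) :
    ∏ q ∈ (Finset.univ : Finset N).image (fun g => g • ((x₀, y₀) : M × M)), q.1 = ∏ x ∈ (Finset.univ : Finset N).image (fun g => g • x₀), x := by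
  rw [orbitProd_fst_eq_pow, hone, pow_one]

/-- The fibre count is `1` or `2` for an affine point of `A : y² = x³ + 4x`: the pairs in the orbit with first coordinate `x₀` have second coordinate `±y₀`.
[cite: TianYuanZhang2017, §3.1 (p0011 L27: A : 2y² = x³ + x, here y² = x³ + 4x)] -/
theorem count_le_two (N : Subgroup (M ≃ₐ[ℚ] M)) {x₀ y₀ : M} (h₀ : (curveA.baseChange M).toAffine.Nonsingular x₀ y₀) :
    (((Finset.univ : Finset N).image (fun g => g • ((x₀, y₀) : M × M))).filter fun q => q.1 = x₀).card ≤ 2 := by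
  -- the filtered set is contained in `{(x₀, y₀), (x₀, -y₀)}`
  have heq : ∀ q ∈ ((Finset.univ : Finset N).image (fun g => g • ((x₀, y₀) : M × M))).filter (fun q => q.1 = x₀),
      q = (x₀, y₀) ∨ q = (x₀, -y₀) := by
    intro q hq
    obtain ⟨hq, hq1⟩ := Finset.mem_filter.mp hq
    obtain ⟨g, -, rfl⟩ := Finset.mem_image.mp hq
    rw [Prod.smul_fst, Subgroup.smul_def, AlgEquiv.smul_def] at hq1
    -- the conjugate point `(g x₀, g y₀)` lies on the curve; with `g x₀ = x₀` its `y` satisfies `y² = y₀²`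
    have hE : y₀ ^ 2 = x₀ ^ 3 + 4 * x₀ := (curveA_nonsingular_iff x₀ y₀).mp h₀
    have hy : ((g : M ≃ₐ[ℚ] M) y₀) ^ 2 = y₀ ^ 2 := by
      have := congrArg (g : M ≃ₐ[ℚ] M) hE
      simp only [map_pow, map_add, map_mul, map_ofNat, hq1] at this
      rw [this, hE]
    rcases sq_eq_sq_iff_eq_or_eq_neg.mp hy with h | h
    · left; rw [Prod.smul_mk, Subgroup.smul_def, Subgroup.smul_def, AlgEquiv.smul_def, AlgEquiv.smul_def, hq1, h]
    · right; rw [Prod.smul_mk, Subgroup.smul_def, Subgroup.smul_def, AlgEquiv.smul_def, AlgEquiv.smul_def, hq1, h]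
  calc (((Finset.univ : Finset N).image (fun g => g • ((x₀, y₀) : M × M))).filter fun q => q.1 = x₀).card
      ≤ ({(x₀, y₀), (x₀, -y₀)} : Finset (M × M)).card :=
        Finset.card_le_card fun q hq => by
          rcases heq q hq with rfl | rfl <;> simp
    _ ≤ 2 := Finset.card_le_two

end Summit.BirchSwinnertonDyer.PrintCf2.TheoremAOrbitReduction

end
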